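import Literature.NumberTheory.Automorphic.FuchsianMaassSelbergContinuation

/-!
# Complex conjugation of Eisenstein series and the norm of the truncated Eisenstein series ((6.27), (6.31))
(Iwaniec, *Spectral Methods of Automorphic Forms*, GSM 53, §6.3 (6.27) `\overline{Φ}(s) = Φ(s̄)`,
PDF p. 87; §6.4 (6.31), PDF p. 88)

Sixteenth brick of the general-`Γ` Eisenstein series (after `FuchsianMaassSelbergContinuation`).
PROVED, nothing vendored, no fact introduced:

1. (§1) conjugation: `E_∞(z, s̄) = \overline{E_∞(z, s)}`, `E_𝔞(z, s̄) = \overline{E_𝔞(z, s)}`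
   (`eisInfty_conj`, `eisCusp_conj`), **(6.27) `φᵢⱼ(s̄) = \overline{φᵢⱼ(s)}`** (`eisScattering_conj`),
   `E(z|ψ̄) = \overline{E(z|ψ)}` (`incEis_conj`, `incEisCusp_conj`), the truncation profile and
   **`E^Y_𝔞(z, s̄) = \overline{E^Y_𝔞(z, s)}`** (`truncProfile_conj`, `eisTrunc_conj`, `Y ≥ 0`).
2. (§2) **(6.31) for `Re s > 1`** (finite volume group, complete system of inequivalent cusps,
   `s = σ + iv`, `v ≠ 0`, `Y ≥ 1`): the complex form `setIntegral_normSq_eisTrunc`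
   (Maass–Selberg `maassSelberg_of_ne` at `(s, s̄)`, where `E^Y(s̄) = \overline{E^Y(s)}`), and the real form
   `maassSelberg_normSq`:
   `‖E^Y_𝔞ᵢ(·, s)‖² + (2σ-1)⁻¹ Y^{1-2σ} Σₖ |φᵢₖ(s)|² = (2σ-1)⁻¹ Y^{2σ-1} - v⁻¹ Im(φᵢᵢ(s) Y^{s̄-s})`
   (`Y^{s̄-s} = Y^{-2iv}`), exactly as printed. (The book uses (6.31) for `σ > 1/2` after the
   meromorphic continuation, to locate the poles of `Φ` — Theorem 6.9; here only `σ > 1`.)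

## References
* [Iwaniec2002] H. Iwaniec, *Spectral Methods of Automorphic Forms*, 2nd ed., GSM 53, AMS 2002,
  (6.27), PDF p. 87; (6.31), PDF p. 88 (held copy `book:iwaniec2002-spectral-methods-automorphic-forms`).

Mathlib: `Complex.cpow_conj`, `Complex.arg_ofReal_of_nonneg`, `RCLike.conj_tsum`, `integral_conj`,
`integral_ofReal`, `Complex.mul_conj`, `Complex.add_conj`, `Complex.sub_conj`, `Complex.ofReal_cpow`.
Literature: `maassSelberg_of_ne` (`FuchsianMaassSelbergContinuation`); `eisTrunc`, `truncProfile`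
(`FuchsianEisensteinTruncation`); `eisScattering` (`FuchsianEisensteinConstantTerm`); `incEis`, `incEisCusp`
(`FuchsianIncompleteEisenstein(Cusp)`); `eisInfty`, `eisCusp`, `eisTerm` (`FuchsianEisensteinSeries`);
`rowIm_nonneg` (`FuchsianGroupCusps`); `cuspMeanAt_apply` (`FuchsianCuspidalSubspace`).
-/

noncomputable section

namespace Literature.NumberTheory.Automorphic

open Matrix UpperHalfPlane
open scoped MatrixGroups ComplexConjugate

namespace Fuchsian

variable {Γ : Subgroup (GL (Fin 2) ℝ)} {h : ℕ} {𝔞 : Fin h → OnePoint ℝ} {σ : Fin h → SL(2, ℝ)}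

/-! ## 1. Complex conjugation of Eisenstein series, constant terms and truncations -/

section Conj

open _root_.MeasureTheory _root_.Set _root_.Filter
open scoped _root_.Pointwise _root_.ENNReal _root_.Topology

/-- `t^{s̄} = \overline{t^s}` for real `t ≥ 0`. [folklore] -/
theorem ofReal_cpow_conj {t : ℝ} (ht : 0 ≤ t) (s : ℂ) : ((t : ℝ) : ℂ) ^ conj s = conj (((t : ℝ) : ℂ) ^ s) := by
  rw [Complex.cpow_conj _ _ (by rw [Complex.arg_ofReal_of_nonneg ht]; exact Real.pi_ne_zero.symm),
    Complex.conj_ofReal]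

/-- `\overline{E_∞(z, s)} = E_∞(z, s̄)`. [cite: Iwaniec2002, (6.27), PDF p. 87] -/
theorem eisInfty_conj (z : ℍ) (s : ℂ) : eisInfty Γ z (conj s) = conj (eisInfty Γ z s) := by
  unfold eisInfty eisTerm
  rw [map_mul, RCLike.conj_tsum]
  congr 1
  · rw [map_div₀, map_one, map_ofNat]
  · exact tsum_congr fun r => ofReal_cpow_conj (rowIm_nonneg _ _) s

/-- `\overline{E_𝔞(z, s)} = E_𝔞(z, s̄)`. [cite: Iwaniec2002, (6.27), PDF p. 87] -/
theorem eisCusp_conj (σ' : SL(2, ℝ)) (z : ℍ) (s : ℂ) : eisCusp Γ σ' z (conj s) = conj (eisCusp Γ σ' z s) :=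
  eisInfty_conj _ _

/-- The cusp mean commutes with conjugation. [folklore] -/
theorem cuspMeanAt_conj (σ' : SL(2, ℝ)) (G : ℍ → ℂ) (w : ℍ) :
    cuspMeanAt σ' (fun z => conj (G z)) w = conj (cuspMeanAt σ' G w) := by
  rw [cuspMeanAt_apply, cuspMeanAt_apply, intervalIntegral.integral_of_le zero_le_one,
    intervalIntegral.integral_of_le zero_le_one, integral_conj]

/-- **(6.27): `\overline{Φ}(s) = Φ(s̄)`** — `φᵢⱼ(s̄) = \overline{φᵢⱼ(s)}`. [cite: Iwaniec2002, (6.27), PDF p. 87] -/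
theorem eisScattering_conj (i j : Fin h) (s : ℂ) :
    eisScattering Γ σ i j (conj s) = conj (eisScattering Γ σ i j s) := by
  unfold eisScattering
  rw [map_sub]
  congr 1
  · rw [← cuspMeanAt_conj]
    congr 1
    funext z
    exact eisCusp_conj (σ i) z s
  · split_ifs <;> simp

/-- `E(z|\overline{ψ}) = \overline{E(z|ψ)}`. [folklore] -/
theorem incEis_conj (ψ : ℝ → ℂ) (z : ℍ) : incEis Γ (fun t => conj (ψ t)) z = conj (incEis Γ ψ z) := by
  unfold incEis
  rw [map_mul, RCLike.conj_tsum]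
  congr 1
  rw [map_div₀, map_one, map_ofNat]

/-- `E_𝔞(z|\overline{ψ}) = \overline{E_𝔞(z|ψ)}`. [folklore] -/
theorem incEisCusp_conj (σ' : SL(2, ℝ)) (ψ : ℝ → ℂ) (z : ℍ) :
    incEisCusp Γ σ' (fun t => conj (ψ t)) z = conj (incEisCusp Γ σ' ψ z) :=
  incEis_conj _ _

/-- The truncation profile at `s̄` is the conjugate profile (`Y ≥ 0`). [folklore] -/
theorem truncProfile_conj (i j : Fin h) (s : ℂ) {Y : ℝ} (hY : 0 ≤ Y) (t : ℝ) :
    truncProfile Γ σ i j (conj s) Y t = conj (truncProfile Γ σ i j s Y t) := by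
  unfold truncProfile
  by_cases hYt : Y < t
  · have ht : 0 ≤ t := hY.trans hYt.le
    rw [if_pos hYt, if_pos hYt, map_add, map_mul, eisScattering_conj,
      show 1 - conj s = conj (1 - s) by rw [map_sub, map_one], ofReal_cpow_conj ht, ofReal_cpow_conj ht]
    congr 1
    split_ifs <;> simp
  · rw [if_neg hYt, if_neg hYt, map_zero]

/-- **`\overline{E^Y_𝔞(z, s)} = E^Y_𝔞(z, s̄)`** (`Y ≥ 0`). [cite: Iwaniec2002, (6.27) & (6.20), PDF p. 87] -/
theorem eisTrunc_conj (i : Fin h) (s : ℂ) {Y : ℝ} (hY : 0 ≤ Y) (z : ℍ) :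
    eisTrunc Γ σ i (conj s) Y z = conj (eisTrunc Γ σ i s Y z) := by
  unfold eisTrunc
  rw [map_sub, map_sum, eisCusp_conj]
  congr 1
  refine Finset.sum_congr rfl fun j _ => ?_
  rw [← incEisCusp_conj]
  congr 1
  funext t
  exact truncProfile_conj i j s hY t

end Conj

/-! ## 2. The norm of the truncated Eisenstein series: (6.31) for `Re s > 1` -/

section NormSq

open _root_.MeasureTheory _root_.Set _root_.Filter
open scoped _root_.Pointwise _root_.ENNReal _root_.Topology

variable {F : Set ℍ}
variable (hΓ : Γ ≤ (Matrix.SpecialLinearGroup.toGL : SL(2, ℝ) →* GL (Fin 2) ℝ).range)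
  (hneg : (-1 : GL (Fin 2) ℝ) ∈ Γ) (hd : IsDiscreteSubgroup Γ) (hF : IsHypFundamentalDomain Γ F)
  (hvol : volume F < ⊤)
  (hinfty : ∀ i, (Matrix.SpecialLinearGroup.toGL (σ i) : GL (Fin 2) ℝ) • (OnePoint.infty : OnePoint ℝ) = 𝔞 i)
  (hper : ∀ i, (ConjAct.toConjAct (Matrix.SpecialLinearGroup.toGL (σ i) : GL (Fin 2) ℝ)⁻¹ • Γ).strictPeriods =
    AddSubgroup.zmultiples 1)
  (hineq : ∀ i j, ∀ γ ∈ Γ, γ • 𝔞 i = 𝔞 j → i = j)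
  (hcomplete : ∀ c : OnePoint ℝ, IsCusp c Γ → ∃ i, ∃ γ ∈ Γ, γ • 𝔞 i = c)

include hΓ hneg hd hF hvol hinfty hper hineq hcomplete in
/-- **Maass–Selberg at `(s, s̄)` as a complex identity**: for `Re s > 1`, `Im s ≠ 0`, `Y ≥ 1`,
`∫_F |E^Y_𝔞ᵢ(z, s)|² dμ = Y^{s+s̄-1}/(s+s̄-1) + \overline{φᵢᵢ(s)} Y^{s-s̄}/(s-s̄) + φᵢᵢ(s) Y^{s̄-s}/(s̄-s) - (Σₖ |φᵢₖ(s)|²) Y^{1-s-s̄}/(s+s̄-1)`.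
[cite: Iwaniec2002, (6.30)–(6.31), PDF p. 88] -/
theorem setIntegral_normSq_eisTrunc (i : Fin h) {s : ℂ} (hs : 1 < s.re) (hv : s.im ≠ 0) {Y : ℝ} (hY : 1 ≤ Y) :
    (((∫ z in F, ‖eisTrunc Γ σ i s Y z‖ ^ 2 : ℝ)) : ℂ) =
      ((Y : ℝ) : ℂ) ^ (s + conj s - 1) / (s + conj s - 1) +
        conj (eisScattering Γ σ i i s) * (((Y : ℝ) : ℂ) ^ (s - conj s) / (s - conj s)) +
        eisScattering Γ σ i i s * (((Y : ℝ) : ℂ) ^ (conj s - s) / (conj s - s)) -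
        (((∑ k, ‖eisScattering Γ σ i k s‖ ^ 2 : ℝ)) : ℂ) * (((Y : ℝ) : ℂ) ^ (1 - s - conj s) / (s + conj s - 1)) := by
  have hY0 : 0 ≤ Y := by linarith
  have hs' : 1 < (conj s).re := by simpa using hs
  have hne : s ≠ conj s := by
    intro h0
    have := congrArg Complex.im h0
    simp at this
    exact hv (by linarith)
  have hm := maassSelberg_of_ne hΓ hneg hd hF hvol hinfty hper hineq hcomplete i i hs hs' hne hY
  rw [if_pos rfl, one_mul, eisScattering_conj] at hm
  have hL : ∫ z in F, eisTrunc Γ σ i s Y z * eisTrunc Γ σ i (conj s) Y z =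
      (((∫ z in F, ‖eisTrunc Γ σ i s Y z‖ ^ 2 : ℝ)) : ℂ) := by
    have e : (fun z => eisTrunc Γ σ i s Y z * eisTrunc Γ σ i (conj s) Y z) =
        fun z => (((‖eisTrunc Γ σ i s Y z‖ ^ 2 : ℝ)) : ℂ) := by
      funext z
      rw [eisTrunc_conj i s hY0 z, Complex.mul_conj, Complex.normSq_eq_norm_sq]
    rw [e]
    exact integral_ofReal
  have hS : ∑ k, eisScattering Γ σ i k s * eisScattering Γ σ i k (conj s) =
      (((∑ k, ‖eisScattering Γ σ i k s‖ ^ 2 : ℝ)) : ℂ) := by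
    push_cast
    refine Finset.sum_congr rfl fun k _ => ?_
    rw [eisScattering_conj, Complex.mul_conj, Complex.normSq_eq_norm_sq]; push_cast; ring
  rw [hL, hS] at hm
  exact hm

include hΓ hneg hd hF hvol hinfty hper hineq hcomplete in
/-- **Iwaniec (6.31) for `Re s > 1`**: with `s = σ + iv`, `v ≠ 0`, `Y ≥ 1`,
`‖E^Y_𝔞ᵢ(·, s)‖² + (2σ-1)⁻¹ Y^{1-2σ} Σₖ |φᵢₖ(s)|² = (2σ-1)⁻¹ Y^{2σ-1} - v⁻¹ Im(φᵢᵢ(s) Y^{-2iv})`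
(here `Y^{s̄ - s} = Y^{-2iv}`). [cite: Iwaniec2002, (6.31), PDF p. 88] -/
theorem maassSelberg_normSq (i : Fin h) {s : ℂ} (hs : 1 < s.re) (hv : s.im ≠ 0) {Y : ℝ} (hY : 1 ≤ Y) :
    (∫ z in F, ‖eisTrunc Γ σ i s Y z‖ ^ 2) + (2 * s.re - 1)⁻¹ * Y ^ (1 - 2 * s.re) * ∑ k, ‖eisScattering Γ σ i k s‖ ^ 2 =
      (2 * s.re - 1)⁻¹ * Y ^ (2 * s.re - 1) -
        (s.im)⁻¹ * (eisScattering Γ σ i i s * ((Y : ℝ) : ℂ) ^ (conj s - s)).im := by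
  have hY0 : 0 < Y := by linarith
  have h := setIntegral_normSq_eisTrunc hΓ hneg hd hF hvol hinfty hper hineq hcomplete i hs hv hY
  -- the exponents and denominators
  have e1 : s + conj s - 1 = (((2 * s.re - 1 : ℝ)) : ℂ) := by
    rw [Complex.add_conj]; push_cast; ring
  have e4 : 1 - s - conj s = (((1 - 2 * s.re : ℝ)) : ℂ) := by
    rw [show 1 - s - conj s = 1 - (s + conj s) by ring, Complex.add_conj]; push_cast; ring
  have e2 : s - conj s = (((2 * s.im : ℝ)) : ℂ) * Complex.I := Complex.sub_conj s
  set w : ℂ := eisScattering Γ σ i i s * ((Y : ℝ) : ℂ) ^ (conj s - s) with hw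
  set T₃ : ℂ := eisScattering Γ σ i i s * (((Y : ℝ) : ℂ) ^ (conj s - s) / (conj s - s)) with hT₃
  have hT₂ : conj (eisScattering Γ σ i i s) * (((Y : ℝ) : ℂ) ^ (s - conj s) / (s - conj s)) = conj T₃ := by
    rw [hT₃, map_mul, map_div₀, ← ofReal_cpow_conj hY0.le, map_sub, Complex.conj_conj]
  have hv2 : (((2 * s.im : ℝ)) : ℂ) ≠ 0 := by exact_mod_cast (mul_ne_zero two_ne_zero hv)
  have hT₃' : T₃ = Complex.I * w / (((2 * s.im : ℝ)) : ℂ) := by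
    rw [hT₃, hw, show conj s - s = -(s - conj s) by ring, e2]
    field_simp
    ring_nf
    rw [Complex.I_sq]; ring
  have hre : T₃.re = -w.im / (2 * s.im) := by
    rw [hT₃', Complex.div_ofReal_re, Complex.mul_re, Complex.I_re, Complex.I_im]; ring
  have h23 : conj T₃ + T₃ = (((-w.im / s.im : ℝ)) : ℂ) := by
    rw [add_comm, Complex.add_conj, hre]
    congr 1; field_simp
  rw [hT₂, e1, e4, add_assoc, h23] at h
  rw [← Complex.ofReal_cpow hY0.le, ← Complex.ofReal_cpow hY0.le] at h
  have h' : ∫ z in F, ‖eisTrunc Γ σ i s Y z‖ ^ 2 =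
      Y ^ (2 * s.re - 1) / (2 * s.re - 1) + -w.im / s.im -
        (∑ k, ‖eisScattering Γ σ i k s‖ ^ 2) * (Y ^ (1 - 2 * s.re) / (2 * s.re - 1)) := by
    exact_mod_cast h
  rw [h']
  ring

end NormSq

end Fuchsian

end Literature.NumberTheory.Automorphic

end
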